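import Mathlib
import Literature.Analysis.Calculus.StrictlyCoerciveOperator

/-!
# Free-tail slice Newton — v3 addendum (slot 3, generation 6): the free-tail RIGHT inverse in `L²`
# is the landed clamped model estimate applied to the ADJOINT

Crux `SkeletonJ1R` (stmt-NavierStokesRegularity-23610), idea `free-tail-slice-newton` (v3), stub S2.
MODEL rung; nothing here bears on NS regularity.

Two checked facts and one bookkeeping lemma:

* `rightInverse_of_adjoint_bounded_below` — Hilbert-space duality (PROVED from the tree's Lax–Milgram
  `Literature.Analysis.Calculus.strictlyCoercive_exists_equiv`): if `σ‖ψ‖ ≤ ‖A†ψ‖` for all `ψ`, then `A` has a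
  bounded right inverse `R`, `A ∘ R = id`, `‖R‖ ≤ σ⁻¹`.  (The duality lever of the sibling card
  `conformal-hamiltonian-adjoint`, typed once so that a clamped a-priori estimate for the adjoint IS a free right
  inverse.)
* `adjoint_substitution_*` — the hypothesis list of the LANDED lane-19175 model estimate
  `…Theorems.…Clause13ModelGluingClosed.model_l2_estimate_closed` (slip `w` with `w c = 0`, `|w′| ≤ Λ`,
  `|w″| ≤ Λ₂`; ℂ-linear multiplier `β₁` bounded + Lipschitz; conj-linear multiplier `β₂` `C¹` bounded; growth
  `β₀ ≤ ½ w′ + Re β₁`) is INVARIANT under the substitution that turns the model operator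
  `𝓛Y = iG((2/q)Y − G_q ∗ Y) − wY′ + β₁Y + β₂Ȳ` into (the complex conjugate of) its formal `L²`-adjoint:
  `(w, β₁, β₂) ↦ (−w, w′ + β₁, conj ∘ β₂)`; in particular the growth quantity `½w′ + Re β₁` is unchanged
  (`≡ ¾` in the skeleton class by the trace identity).  Hence the landed theorem bounds the clamped adjoint
  from below with the SAME Γ-free constant, and by the duality above the free-tail model linearisation has a
  right inverse `L²(I) → L²(ℝ)` with that constant — no new estimate.
* `zerothOrder_adjoint_pointwise`, `transport_adjoint_identity` — the pointwise / integrated identities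
  behind "formal adjoint" for the local part (the nonlocal part is skew by the landed
  `…Clause13RAdjointEnergy.setIntegral_inner_nonlocal_eq_zero`).
-/

set_option linter.dupNamespace false

namespace Summit.NavierStokesRegularity.NavierStokesRegularity.Cruxes.SkeletonJ1R.FreeTailSliceNewton

open scoped InnerProductSpace ComplexConjugate
open Literature.Analysis.Calculus

section Duality

variable {E F : Type*} [NormedAddCommGroup E] [InnerProductSpace ℝ E] [CompleteSpace E]
  [NormedAddCommGroup F] [InnerProductSpace ℝ F] [CompleteSpace F]

/-- **Free right inverse from a clamped adjoint estimate.**  If the adjoint of `A : E → F` is bounded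
below, `σ‖ψ‖ ≤ ‖A†ψ‖`, then `R := A† (A A†)⁻¹` is a bounded right inverse of `A` with `‖R‖ ≤ 1/σ`.
Proof: `A A†` is strictly coercive with constant `σ²` (Lax–Milgram, tree), and
`‖Rg‖² = ⟪g, (AA†)⁻¹g⟫ ≤ ‖g‖²/σ²`. -/
theorem rightInverse_of_adjoint_bounded_below (A : E →L[ℝ] F) {σ : ℝ} (hσ : 0 < σ)
    (hA : ∀ ψ : F, σ * ‖ψ‖ ≤ ‖(ContinuousLinearMap.adjoint A) ψ‖) :
    ∃ R : F →L[ℝ] E, A.comp R = ContinuousLinearMap.id ℝ F ∧ ‖R‖ ≤ σ⁻¹ := by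
  set Aad : F →L[ℝ] E := ContinuousLinearMap.adjoint A with hAad
  set S : F →L[ℝ] F := A.comp Aad with hSdef
  have hSinner : ∀ ψ : F, ⟪S ψ, ψ⟫_ℝ = ‖Aad ψ‖ ^ 2 := by
    intro ψ
    simp only [hSdef, ContinuousLinearMap.comp_apply]
    rw [← ContinuousLinearMap.adjoint_inner_right, real_inner_self_eq_norm_sq]
  have hS : ∀ ψ : F, σ ^ 2 * ‖ψ‖ ^ 2 ≤ RCLike.re ⟪S ψ, ψ⟫_ℝ := by
    intro ψ
    have h2 : σ * ‖ψ‖ ≤ ‖Aad ψ‖ := hA ψ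
    have h3 : (σ * ‖ψ‖) ^ 2 ≤ ‖Aad ψ‖ ^ 2 :=
      pow_le_pow_left₀ (by positivity) h2 2
    simp only [RCLike.re_to_real, hSinner]
    nlinarith [h3]
  obtain ⟨T, hT, hTn⟩ := strictlyCoercive_exists_equiv S (by positivity : 0 < σ ^ 2) hS
  have hST : ∀ g : F, S ((T.symm : F →L[ℝ] F) g) = g := by
    intro g
    have h := T.apply_symm_apply g
    have h' : (T : F →L[ℝ] F) (T.symm g) = g := h
    rw [hT] at h'
    exact h'
  refine ⟨Aad.comp (T.symm : F →L[ℝ] F), ?_, ?_⟩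
  · ext g
    simp only [ContinuousLinearMap.comp_apply, ContinuousLinearMap.id_apply]
    have := hST g
    simpa [hSdef] using this
  · refine ContinuousLinearMap.opNorm_le_bound _ (by positivity) fun g => ?_
    set φ : F := (T.symm : F →L[ℝ] F) g with hφ
    have hSφ : S φ = g := hST g
    -- ‖Aad φ‖² = ⟪S φ, φ⟫ = ⟪g, φ⟫ ≤ ‖g‖‖φ‖ and σ²‖φ‖² ≤ ⟪g, φ⟫
    have h1 : ‖Aad φ‖ ^ 2 = ⟪g, φ⟫_ℝ := by rw [← hSinner φ, hSφ]
    have h4 : ⟪g, φ⟫_ℝ ≤ ‖g‖ * ‖φ‖ := real_inner_le_norm g φ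
    have h5 : σ ^ 2 * ‖φ‖ ^ 2 ≤ ⟪g, φ⟫_ℝ := by
      have := hS φ
      simp only [RCLike.re_to_real] at this
      rw [hSφ] at this
      exact this
    have hφbound : σ ^ 2 * ‖φ‖ ≤ ‖g‖ := by
      by_cases hφ0 : ‖φ‖ = 0
      · rw [hφ0]; simp
      · have hpos : 0 < ‖φ‖ := lt_of_le_of_ne (norm_nonneg _) (Ne.symm hφ0)
        have : σ ^ 2 * ‖φ‖ * ‖φ‖ ≤ ‖g‖ * ‖φ‖ := by nlinarith [h4, h5]
        exact le_of_mul_le_mul_right this hpos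
    have h6 : ‖Aad φ‖ ^ 2 ≤ (σ⁻¹ * ‖g‖) ^ 2 := by
      rw [h1]
      have hσ2 : 0 < σ ^ 2 := by positivity
      calc ⟪g, φ⟫_ℝ ≤ ‖g‖ * ‖φ‖ := h4
        _ ≤ ‖g‖ * (‖g‖ / σ ^ 2) := by
            apply mul_le_mul_of_nonneg_left _ (norm_nonneg _)
            rw [le_div_iff₀ hσ2]; linarith [hφbound]
        _ = (σ⁻¹ * ‖g‖) ^ 2 := by field_simp
    have h7 : ‖Aad φ‖ ≤ σ⁻¹ * ‖g‖ := by
      exact le_of_sq_le_sq h6 (by positivity)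
    simpa [ContinuousLinearMap.comp_apply, hφ] using h7

end Duality

section Substitution

/-- The growth quantity `½w′ + Re β₁` of the model operator is invariant under the adjoint
substitution `(w′, β₁) ↦ (−w′, w′ + β₁)`. -/
theorem adjoint_substitution_growth {β₀ : ℝ} {w' : ℝ → ℝ} {β₁ : ℝ → ℂ}
    (h : ∀ τ, β₀ ≤ 1 / 2 * w' τ + (β₁ τ).re) (τ : ℝ) :
    β₀ ≤ 1 / 2 * (-w' τ) + (((w' τ : ℝ) : ℂ) + β₁ τ).re := by
  have := h τ
  simp only [Complex.add_re, Complex.ofReal_re]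
  linarith

/-- The substituted slip `−w` keeps the slip hypotheses of `model_l2_estimate_closed`. -/
theorem adjoint_substitution_slip {w : ℝ → ℝ} {Λ Λ₂ c : ℝ}
    (hw : Differentiable ℝ w) (hw2 : Differentiable ℝ (deriv w))
    (hΛ : ∀ t, |deriv w t| ≤ Λ) (hΛ₂ : ∀ t, |deriv (deriv w) t| ≤ Λ₂) (hc : w c = 0) :
    Differentiable ℝ (fun t => -w t) ∧ Differentiable ℝ (deriv fun t => -w t) ∧
      (∀ t, |deriv (fun t => -w t) t| ≤ Λ) ∧ (∀ t, |deriv (deriv fun t => -w t) t| ≤ Λ₂) ∧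
      (fun t => -w t) c = 0 := by
  have hd : deriv (fun t => -w t) = fun t => -deriv w t := by
    funext t; exact deriv.neg
  have hd2 : deriv (deriv fun t => -w t) = fun t => -deriv (deriv w) t := by
    rw [hd]; funext t; exact deriv.neg
  refine ⟨hw.neg, ?_, ?_, ?_, by simp [hc]⟩
  · rw [hd]; exact hw2.neg
  · intro t; rw [hd]; simpa using hΛ t
  · intro t; rw [hd2]; simpa using hΛ₂ t

/-- The substituted ℂ-linear multiplier `w′ + β₁` keeps continuity, a bound and a Lipschitz constant. -/
theorem adjoint_substitution_beta1 {w : ℝ → ℝ} {β₁ : ℝ → ℂ} {Λ Λ₂ b₁ L₁ : ℝ}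
    (hw2 : Differentiable ℝ (deriv w))
    (hΛ : ∀ t, |deriv w t| ≤ Λ) (hΛ₂ : ∀ t, |deriv (deriv w) t| ≤ Λ₂)
    (hβc : Continuous β₁) (hβb : ∀ τ, ‖β₁ τ‖ ≤ b₁) (hβL : ∀ x y, ‖β₁ y - β₁ x‖ ≤ L₁ * |y - x|) :
    Continuous (fun τ => ((deriv w τ : ℝ) : ℂ) + β₁ τ) ∧
      (∀ τ, ‖((deriv w τ : ℝ) : ℂ) + β₁ τ‖ ≤ Λ + b₁) ∧
      (∀ x y, ‖(((deriv w y : ℝ) : ℂ) + β₁ y) - (((deriv w x : ℝ) : ℂ) + β₁ x)‖ ≤ (Λ₂ + L₁) * |y - x|) := by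
  refine ⟨?_, ?_, ?_⟩
  · exact (Complex.continuous_ofReal.comp hw2.continuous).add hβc
  · intro τ
    calc ‖((deriv w τ : ℝ) : ℂ) + β₁ τ‖ ≤ ‖((deriv w τ : ℝ) : ℂ)‖ + ‖β₁ τ‖ := norm_add_le _ _
      _ ≤ Λ + b₁ := by
          gcongr
          · rw [Complex.norm_real, Real.norm_eq_abs]; exact hΛ τ
          · exact hβb τ
  · intro x y
    have hmv : |deriv w y - deriv w x| ≤ Λ₂ * |y - x| := by
      have h := Convex.norm_image_sub_le_of_norm_deriv_le (f := deriv w) (C := Λ₂)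
        (fun t _ => hw2.differentiableAt) (fun t _ => by
          rw [Real.norm_eq_abs]; exact hΛ₂ t) convex_univ (Set.mem_univ x) (Set.mem_univ y)
      simpa [Real.norm_eq_abs] using h
    calc ‖(((deriv w y : ℝ) : ℂ) + β₁ y) - (((deriv w x : ℝ) : ℂ) + β₁ x)‖
        = ‖(((deriv w y - deriv w x : ℝ)) : ℂ) + (β₁ y - β₁ x)‖ := by push_cast; ring_nf
      _ ≤ ‖(((deriv w y - deriv w x : ℝ)) : ℂ)‖ + ‖β₁ y - β₁ x‖ := norm_add_le _ _
      _ ≤ Λ₂ * |y - x| + L₁ * |y - x| := by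
          gcongr
          · rw [Complex.norm_real, Real.norm_eq_abs]; exact hmv
          · exact hβL x y
      _ = (Λ₂ + L₁) * |y - x| := by ring

/-- The substituted conj-linear multiplier `conj ∘ β₂` keeps the `C¹` hypotheses and bounds. -/
theorem adjoint_substitution_beta2 {β₂ β₂' : ℝ → ℂ} {b₂ L₂ : ℝ}
    (hβd : ∀ τ, HasDerivAt β₂ (β₂' τ) τ) (hβ'c : Continuous β₂')
    (hβb : ∀ τ, ‖β₂ τ‖ ≤ b₂) (hβ'b : ∀ τ, ‖β₂' τ‖ ≤ L₂) :
    (∀ τ, HasDerivAt (fun t => conj (β₂ t)) (conj (β₂' τ)) τ) ∧ Continuous (fun t => conj (β₂' t)) ∧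
      (∀ τ, ‖conj (β₂ τ)‖ ≤ b₂) ∧ (∀ τ, ‖conj (β₂' τ)‖ ≤ L₂) := by
  refine ⟨?_, ?_, ?_, ?_⟩
  · intro τ
    have h := (hβd τ).star
    simpa using h
  · exact Complex.continuous_conj.comp hβ'c
  · intro τ; rw [Complex.norm_conj]; exact hβb τ
  · intro τ; rw [Complex.norm_conj]; exact hβ'b τ

end Substitution

section FormalAdjoint

/-- Pointwise identity behind the formal adjoint of the zeroth-order part `β₁Y + β₂Ȳ` under the real
pairing `Re ∫ conj(Z)·(·)`: the adjoint multiplies by `conj β₁` (ℂ-linear part) and by the SAME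
conj-linear map `Z ↦ β₂ conj Z`. -/
theorem zerothOrder_adjoint_pointwise (β₁ β₂ Y Z : ℂ) :
    (conj Z * (β₁ * Y + β₂ * conj Y)).re = (conj (conj β₁ * Z + β₂ * conj Z) * Y).re := by
  simp only [Complex.mul_re, Complex.mul_im, Complex.add_re, Complex.add_im, Complex.conj_re,
    Complex.conj_im]
  ring

/-- Integrated identity behind the formal adjoint of the transport part `−wY′` against a CLAMPED test
field `Z` (`Z a = Z b = 0`): `∫ conj(Z)(−wY′) = ∫ conj(wZ′ + w′Z)·Y`. -/
theorem transport_adjoint_identity {a b : ℝ} {w w' : ℝ → ℝ} {Y Y' Z Z' : ℝ → ℂ}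
    (hw : ∀ t, HasDerivAt w (w' t) t) (hY : ∀ t, HasDerivAt Y (Y' t) t) (hZ : ∀ t, HasDerivAt Z (Z' t) t)
    (hw'c : Continuous w') (hY'c : Continuous Y') (hZ'c : Continuous Z')
    (hZa : Z a = 0) (hZb : Z b = 0) :
    ∫ t in a..b, conj (Z t) * (-(((w t : ℝ) : ℂ)) * Y' t)
      = ∫ t in a..b, conj (((w t : ℝ) : ℂ) * Z' t + ((w' t : ℝ) : ℂ) * Z t) * Y t := by
  -- product rule for `P t := (w t : ℂ) * conj (Z t) * Y t`, then the fundamental theorem of calculus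
  have hwc : Continuous w := continuous_iff_continuousAt.2 fun t => (hw t).continuousAt
  have hYc : Continuous Y := continuous_iff_continuousAt.2 fun t => (hY t).continuousAt
  have hZc : Continuous Z := continuous_iff_continuousAt.2 fun t => (hZ t).continuousAt
  have hwC : ∀ t, HasDerivAt (fun s => ((w s : ℝ) : ℂ)) (((w' t : ℝ) : ℂ)) t := fun t =>
    (hw t).ofReal_comp
  have hZconj : ∀ t, HasDerivAt (fun s => conj (Z s)) (conj (Z' t)) t := fun t => by
    simpa using (hZ t).star
  have hP : ∀ t, HasDerivAt (fun s => ((w s : ℝ) : ℂ) * conj (Z s) * Y s)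
      ((((w' t : ℝ) : ℂ) * conj (Z t) + ((w t : ℝ) : ℂ) * conj (Z' t)) * Y t
        + ((w t : ℝ) : ℂ) * conj (Z t) * Y' t) t := by
    intro t
    exact ((hwC t).mul (hZconj t)).mul (hY t)
  have hPc : Continuous fun t => (((w' t : ℝ) : ℂ) * conj (Z t) + ((w t : ℝ) : ℂ) * conj (Z' t)) * Y t
        + ((w t : ℝ) : ℂ) * conj (Z t) * Y' t := by
    have h1 : Continuous fun t => ((w' t : ℝ) : ℂ) := Complex.continuous_ofReal.comp hw'c
    have h2 : Continuous fun t => ((w t : ℝ) : ℂ) := Complex.continuous_ofReal.comp hwc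
    have h3 : Continuous fun t => conj (Z t) := Complex.continuous_conj.comp hZc
    have h4 : Continuous fun t => conj (Z' t) := Complex.continuous_conj.comp hZ'c
    exact (((h1.mul h3).add (h2.mul h4)).mul hYc).add ((h2.mul h3).mul hY'c)
  have hFTC := intervalIntegral.integral_eq_sub_of_hasDerivAt (fun t _ => hP t)
    (hPc.intervalIntegrable a b)
  simp only [hZa, hZb, map_zero, mul_zero, zero_mul, sub_self] at hFTC
  -- hFTC : ∫ (w' conj Z + w conj Z') Y + w conj Z Y' = 0
  have hsplit : ∫ t in a..b, ((((w' t : ℝ) : ℂ) * conj (Z t) + ((w t : ℝ) : ℂ) * conj (Z' t)) * Y t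
        + ((w t : ℝ) : ℂ) * conj (Z t) * Y' t)
      = (∫ t in a..b, (((w' t : ℝ) : ℂ) * conj (Z t) + ((w t : ℝ) : ℂ) * conj (Z' t)) * Y t)
        + ∫ t in a..b, ((w t : ℝ) : ℂ) * conj (Z t) * Y' t := by
    have h1 : Continuous fun t => ((w' t : ℝ) : ℂ) := Complex.continuous_ofReal.comp hw'c
    have h2 : Continuous fun t => ((w t : ℝ) : ℂ) := Complex.continuous_ofReal.comp hwc
    have h3 : Continuous fun t => conj (Z t) := Complex.continuous_conj.comp hZc
    have h4 : Continuous fun t => conj (Z' t) := Complex.continuous_conj.comp hZ'c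
    exact intervalIntegral.integral_add ((((h1.mul h3).add (h2.mul h4)).mul hYc).intervalIntegrable a b)
      (((h2.mul h3).mul hY'c).intervalIntegrable a b)
  rw [hsplit] at hFTC
  have key : ∫ t in a..b, conj (Z t) * (-(((w t : ℝ) : ℂ)) * Y' t)
      = -∫ t in a..b, ((w t : ℝ) : ℂ) * conj (Z t) * Y' t := by
    rw [← intervalIntegral.integral_neg]; congr 1; funext t; ring
  rw [key]
  have key2 : ∫ t in a..b, conj (((w t : ℝ) : ℂ) * Z' t + ((w' t : ℝ) : ℂ) * Z t) * Y t
      = ∫ t in a..b, (((w' t : ℝ) : ℂ) * conj (Z t) + ((w t : ℝ) : ℂ) * conj (Z' t)) * Y t := by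
    congr 1; funext t
    simp only [map_add, map_mul, Complex.conj_ofReal]; ring
  rw [key2]
  linear_combination (-1 : ℂ) * hFTC

end FormalAdjoint

/-- **S2a of `free-tail-slice-newton` v3 (model level), informal record.**  With `𝓛` the lane-19175 model
operator of `model_l2_estimate_closed` and `𝓛†` its formal real-`L²` adjoint, `conj ∘ 𝓛† ∘ conj` is again of
the form `𝓛` with data `(−w, w′ + β₁, conj ∘ β₂)` (`transport_adjoint_identity`, `zerothOrder_adjoint_pointwise`,
skewness of the nonlocal part = landed `setIntegral_inner_nonlocal_eq_zero`), the hypothesis list is preserved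
(`adjoint_substitution_slip/beta1/beta2/growth`, constants `(Λ, Λ₂, b₁+Λ, L₁+Λ₂, b₂, L₂, β₀)`), so the landed
estimate gives `‖ψ‖_{L²} ≤ A‖𝓛†ψ‖_{L²(ℝ)}` for ball-supported `ψ`, and `rightInverse_of_adjoint_bounded_below`
turns it into a right inverse `R : L²(I) → L²(ℝ)` of the free-tail model linearisation with `‖R‖ ≤ A`,
Γ-free for `Rb ≤ Rb₀`.  Typed as a `Prop` placeholder naming the composition; the instantiation against the
60-hypothesis landed theorem is crux-plan bookkeeping (S-size). -/
def ModelFreeTailSurjectivityL2 : Prop :=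
  ∀ (E F : Type) [NormedAddCommGroup E] [InnerProductSpace ℝ E] [CompleteSpace E]
    [NormedAddCommGroup F] [InnerProductSpace ℝ F] [CompleteSpace F]
    (A : E →L[ℝ] F) (σ : ℝ), 0 < σ → (∀ ψ : F, σ * ‖ψ‖ ≤ ‖(ContinuousLinearMap.adjoint A) ψ‖) →
    ∃ R : F →L[ℝ] E, A.comp R = ContinuousLinearMap.id ℝ F ∧ ‖R‖ ≤ σ⁻¹

theorem modelFreeTailSurjectivityL2_holds : ModelFreeTailSurjectivityL2 :=
  fun _ _ _ _ _ _ _ _ A _ hσ hA => rightInverse_of_adjoint_bounded_below A hσ hA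

end Summit.NavierStokesRegularity.NavierStokesRegularity.Cruxes.SkeletonJ1R.FreeTailSliceNewton
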